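import Mathlib
import HarnessLib
import Summits.HubbardSuperconductivity.HubbardSuperconductivity.Theorems.KLProgrammeKLRegimeSplitBundleV12

/-!
# Route `KLProgramme` — crux K3, ENGINE child (gen 3 `KLRegimeEngineV11` stmt-HubbardSuperconductivity-19823 / its gen-4 successor on
# `klPredsV12`): the two TEXT-SIDE FACTS behind the negative-mass edge clause of (E2-v8) `PairLadderStepAtV8` — termwise positivity of the
# slice pair weights DEEP INSIDE the pair class, and the discharge shape of the clause (cell gate-hubbard-kl, seat p1 g7 = clause author)

(E2-v8) (`…SplitBundleV12`, Δ21) asks, at `1 ≤ n` and a pair-class `Qm`, for real weights `w` with `Σ|w| ≤ G.bhi` and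
`Σ(|w| − w) ≤ 2·klEdge G n |Qm|_𝕋`.  The engine takes `w_p := Σ_ν Re z′_(p,ν)`, `z′_(p,ν) = (βL²)⁻¹·ρ₁ρ₂/((iν − e_K(p))(−iν − e_K(Qm−p)))`
(`ρᵢ ≥ 0` the slice multipliers).  This file proves, model-free:
* §1 `kled_sq_add_mul_nonneg`: if ONE of the two energies sits on the slice (`Λ²/4 ≤ ν² + e₁²`) and the pair-energy gap is `|e₁ − e₂| ≤ Λ/2`,
  then `0 ≤ ν² + e₁e₂` (plan g10 HOME/STATUS l.1197 (i) / k3c1-p2 l.1233: an opposite-sign pair would need `|e₁| ≤ |e₁ − e₂| ≤ Λ/2`, and then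
  `ν² + e₁e₂ ≥ Λ²/4 − |e₁|·|e₁ − e₂| ≥ 0`); `kled_pairDenom_re` (`Re((iν − e₁)(−iν − e₂)) = ν² + e₁e₂`, the BGM convention
  `(−iν + e₁)(iν + e₂)` is the SAME number: `kled_pairDenom_eq`); `kled_pairWeight_re_nonneg` (`0 ≤ Re(a/((iν − e₁)(−iν − e₂)))` for real
  `a ≥ 0` once `0 ≤ ν² + e₁e₂`) and the slice form `kled_pairWeight_re_nonneg_of_slice` — so deep inside the class EVERY summand of `w_p` is `≥ 0`;
* §2 the clause discharge `kled_negMass_clause`: `Σ|w| ≤ G.bhi`, `0 ≤ G.bhi`, `0 ≤ ρ`, and «`klEdgeKappa·ρ < Λ_n` ⇒ `w ≥ 0` pointwise» give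
  `Σ_p (|w p| − w p) ≤ 2·klEdge G n ρ` (deep inside: the sum is `0`; edge zone: `klEdge = G.bhi` and `Σ(|w| − w) ≤ 2Σ|w|`) — the engine's
  (E2-v8) negative-mass conjunct is therefore ONE geometric input away: `64·|Qm|_𝕋 < Λ_n ⇒ |e_K(p) − e_K(Qm − p)| ≤ Λ_n/2` on the slice
  (`FrameOK` (i): `‖∇e_K‖ ≤ 7`; `kled_gap_of_gradient`: `7·(√2·ρ) ≤ Λ/2` whenever `64ρ ≤ Λ`… stated with the Euclidean step `d ≤ √2·ρ`).
* §4 `kled_sum_min_one_edge_le` / `kled_sum_klEdge_le(_of_isPairClassAt)`: per pair-class momentum the edge allowance is scale-summable,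
  `Σ_{j ≤ m} klEdge G j |Qm|_𝕋 ≤ 7·G.bhi` (child 1's signed-cascade growth exponent; k3c1-p2 l.1233 «scale sum ≤ s + 1 + 1/3»).
* §6 (append) `kled_sum_norm_pairWeight_le_mass` / `kled_sum_abs_aggregated_le_mass`: the total variation of the slice pair weights at ANY total
  momentum is bounded by the `Q = 0` slice bubble mass (AM–GM + the reindexing `(ν,p) ↦ (−ν, Qm − p)`), so `Σ|w| ≤ G.bhi` is ONE number.
* §7 (append) `kled_mass_le_card_mul_card`: the `Q = 0` mass itself is SIGN-BLIND — `≤ (4/Λ²)·#{i : |ω_i| < 4Λ}·#{p : |e_p| < 4Λ}` for multipliers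
  `|a| ≤ 1` supported on the slice `Λ²/4 < ω² + e² < (4Λ)²`.
Pure real/complex arithmetic; nothing about the model is asserted.  Honest framing: helper inequalities for an engine stub; no stub is proved here.
-/

noncomputable section

namespace Summit.HubbardSuperconductivity.HubbardSuperconductivity.Theorems.KLRegimeSplit

set_option linter.dupNamespace false -- summit = problem name (single-conjunct summit), D-0017

open Real Finset Complex Literature.MathematicalPhysics.QuantumLattice Literature.Probability.LatticeModels
open Summit.HubbardSuperconductivity.HubbardSuperconductivity.Theorems.KLProgrammeLegKernels

/-! ## §1 Termwise positivity deep inside the class -/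

/-- **No negative pair weight deep inside the class.**  If `Λ²/4 ≤ ν² + e₁²` (the first propagator is on the slice) and the pair-energy gap
is `|e₁ − e₂| ≤ Λ/2`, then `0 ≤ ν² + e₁·e₂`. -/
theorem kled_sq_add_mul_nonneg {ν e₁ e₂ Λ : ℝ} (h₁ : Λ ^ 2 / 4 ≤ ν ^ 2 + e₁ ^ 2) (h : |e₁ - e₂| ≤ Λ / 2) :
    0 ≤ ν ^ 2 + e₁ * e₂ := by
  by_cases hs : 0 ≤ e₁ * e₂
  · positivity
  · -- opposite signs: `|e₁ - e₂| = |e₁| + |e₂| ≤ Λ/2`, so `ν² + e₁e₂ = (ν² + |e₁|²) − |e₁|(|e₁| + |e₂|) ≥ Λ²/4 − (Λ/2)² = 0`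
    have hs : e₁ * e₂ < 0 := lt_of_not_ge hs
    have hgap : |e₁ - e₂| = |e₁| + |e₂| := by
      rcases lt_or_gt_of_ne (show e₁ ≠ 0 by rintro rfl; simp at hs) with h1 | h1
      · have h2 : 0 < e₂ := by nlinarith
        rw [abs_of_neg (by linarith : e₁ - e₂ < 0), abs_of_neg h1, abs_of_pos h2]; ring
      · have h2 : e₂ < 0 := by nlinarith
        rw [abs_of_pos (by linarith : 0 < e₁ - e₂), abs_of_pos h1, abs_of_neg h2]; ring
    set A := |e₁| with hA_def
    set B := |e₂| with hB_def
    have hprod : e₁ * e₂ = -(A * B) := by rw [hA_def, hB_def, ← abs_mul, abs_of_neg hs]; ring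
    have ha1 : 0 ≤ A := abs_nonneg _
    have ha2 : 0 ≤ B := abs_nonneg _
    have hle : A + B ≤ Λ / 2 := hgap ▸ h
    have h₁' : Λ ^ 2 / 4 ≤ ν ^ 2 + A ^ 2 := by rwa [hA_def, sq_abs]
    have hAB : A * (A + B) ≤ A * (Λ / 2) := mul_le_mul_of_nonneg_left hle ha1
    have hA2 : A * (Λ / 2) ≤ Λ / 2 * (Λ / 2) := mul_le_mul_of_nonneg_right (by linarith) (by linarith)
    rw [hprod]
    nlinarith

/-- The symmetric form: the SECOND propagator on the slice suffices as well. -/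
theorem kled_sq_add_mul_nonneg' {ν e₁ e₂ Λ : ℝ} (h₂ : Λ ^ 2 / 4 ≤ ν ^ 2 + e₂ ^ 2) (h : |e₁ - e₂| ≤ Λ / 2) :
    0 ≤ ν ^ 2 + e₁ * e₂ := by
  rw [mul_comm]; exact kled_sq_add_mul_nonneg h₂ (by rwa [abs_sub_comm])

/-- The pair denominator `(iν − e₁)(−iν − e₂)` has real part `ν² + e₁e₂` (its imaginary part `ν(e₁ − e₂)` is odd in `ν`). -/
theorem kled_pairDenom_re (ν e₁ e₂ : ℝ) : ((I * ν - e₁) * (-I * ν - e₂)).re = ν ^ 2 + e₁ * e₂ := by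
  simp only [mul_re, sub_re, sub_im, mul_im, neg_re, neg_im, I_re, I_im, ofReal_re, ofReal_im]
  ring

/-- Its imaginary part is `ν·(e₁ − e₂)`. -/
theorem kled_pairDenom_im (ν e₁ e₂ : ℝ) : ((I * ν - e₁) * (-I * ν - e₂)).im = ν * (e₁ - e₂) := by
  simp only [mul_re, sub_re, sub_im, mul_im, neg_re, neg_im, I_re, I_im, ofReal_re, ofReal_im]
  ring

/-- BGM's convention `C(k) = 1/(−ik₀ + e)`: the denominator `(−iν + e₁)(iν + e₂)` is the SAME complex number. -/
theorem kled_pairDenom_eq (ν e₁ e₂ : ℝ) : ((-I * ν + e₁) * (I * ν + e₂) : ℂ) = (I * ν - e₁) * (-I * ν - e₂) := by ring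

/-- Its squared modulus is `(ν² + e₁²)(ν² + e₂²)`. -/
theorem kled_pairDenom_normSq (ν e₁ e₂ : ℝ) : normSq ((I * ν - e₁) * (-I * ν - e₂)) = (ν ^ 2 + e₁ ^ 2) * (ν ^ 2 + e₂ ^ 2) := by
  rw [map_mul]
  simp only [normSq_apply, sub_re, sub_im, mul_re, mul_im, neg_re, neg_im, I_re, I_im, ofReal_re, ofReal_im]
  ring

/-- **Termwise positivity of the pair weight's real part**: for a real numerator `a ≥ 0` (product of the two slice multipliers) and
`0 ≤ ν² + e₁e₂`, `0 ≤ Re (a / ((iν − e₁)(−iν − e₂)))`. -/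
theorem kled_pairWeight_re_nonneg {a ν e₁ e₂ : ℝ} (ha : 0 ≤ a) (h : 0 ≤ ν ^ 2 + e₁ * e₂) :
    0 ≤ ((a : ℂ) / ((I * ν - e₁) * (-I * ν - e₂))).re := by
  rw [div_re, ofReal_re, ofReal_im, zero_mul, zero_div, add_zero, kled_pairDenom_re]
  exact div_nonneg (mul_nonneg ha h) (normSq_nonneg _)

/-- The real part in closed form: `Re (a/((iν − e₁)(−iν − e₂))) = a·(ν² + e₁e₂)/((ν² + e₁²)(ν² + e₂²))`. -/
theorem kled_pairWeight_re_eq (a ν e₁ e₂ : ℝ) :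
    ((a : ℂ) / ((I * ν - e₁) * (-I * ν - e₂))).re = a * (ν ^ 2 + e₁ * e₂) / ((ν ^ 2 + e₁ ^ 2) * (ν ^ 2 + e₂ ^ 2)) := by
  rw [div_re, ofReal_re, ofReal_im, zero_mul, zero_div, add_zero, kled_pairDenom_re, kled_pairDenom_normSq]

/-- **The slice form**: first propagator on the slice (`Λ²/4 ≤ ν² + e₁²`), gap `|e₁ − e₂| ≤ Λ/2`, multipliers' product `a ≥ 0` ⇒ the
pair weight has nonnegative real part. -/
theorem kled_pairWeight_re_nonneg_of_slice {a ν e₁ e₂ Λ : ℝ} (ha : 0 ≤ a) (h₁ : Λ ^ 2 / 4 ≤ ν ^ 2 + e₁ ^ 2)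
    (h : |e₁ - e₂| ≤ Λ / 2) : 0 ≤ ((a : ℂ) / ((I * ν - e₁) * (-I * ν - e₂))).re :=
  kled_pairWeight_re_nonneg ha (kled_sq_add_mul_nonneg h₁ h)

/-- The aggregated weight `w_p = Σ_ν Re z′_(p,ν)` is nonnegative when every summand is (bookkeeping form for a `Finset` of frequencies). -/
theorem kled_sum_re_nonneg {ι : Type*} (s : Finset ι) {z : ι → ℂ} (h : ∀ i ∈ s, 0 ≤ (z i).re) : 0 ≤ (∑ i ∈ s, z i).re := by
  rw [re_sum]; exact sum_nonneg h

/-! ## §2 The discharge shape of the negative-mass clause -/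

section Clause

variable {S : Type*} [Fintype S]

/-- For pointwise-nonnegative weights the negative mass vanishes: `Σ(|w| − w) = 0`. -/
theorem kled_sum_abs_sub_self_eq_zero {w : S → ℝ} (hw : ∀ p, 0 ≤ w p) : ∑ p, (|w p| - w p) = 0 :=
  sum_eq_zero fun p _ => by rw [abs_of_nonneg (hw p), sub_self]

/-- The negative mass is at most twice the total variation: `Σ(|w| − w) ≤ 2·Σ|w|`. -/
theorem kled_sum_abs_sub_self_le (w : S → ℝ) : ∑ p, (|w p| - w p) ≤ 2 * ∑ p, |w p| := by
  rw [two_mul, ← sum_add_distrib]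
  exact sum_le_sum fun p _ => by linarith [neg_abs_le (w p)]

/-- `Σ(|w| − w) = 2·Σ w⁻` (the clause controls exactly the NEGATIVE mass). -/
theorem kled_sum_abs_sub_self_eq_two_mul_negPart (w : S → ℝ) : ∑ p, (|w p| - w p) = 2 * ∑ p, max (-w p) 0 := by
  rw [mul_sum]
  refine sum_congr rfl fun p _ => ?_
  rcases le_or_gt 0 (w p) with h | h
  · rw [abs_of_nonneg h, max_eq_right (by linarith)]; ring
  · rw [abs_of_neg h, max_eq_left (by linarith)]; ring

/-- **The (E2-v8) negative-mass conjunct, discharged from ONE implication.**  If the weights have total variation `≤ G.bhi` (`G.bhi ≥ 0`,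
`ρ ≥ 0`) and are pointwise nonnegative whenever the momentum is deep inside the class (`klEdgeKappa·ρ < Λ_n`), then
`Σ(|w| − w) ≤ 2·klEdge G n ρ`.  (Deep inside the sum is `0`; in the edge zone `klEdge G n ρ = G.bhi`.) -/
theorem kled_negMass_clause {G : GeoConsts} (hG : 0 ≤ G.bhi) {n : ℕ} {ρ : ℝ} (hρ : 0 ≤ ρ) {w : S → ℝ}
    (hmass : ∑ p, |w p| ≤ G.bhi) (hdeep : klEdgeKappa * ρ < klScale klE0 n → ∀ p, 0 ≤ w p) :
    ∑ p, (|w p| - w p) ≤ 2 * klEdge G n ρ := by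
  by_cases h : klEdgeKappa * ρ < klScale klE0 n
  · rw [kled_sum_abs_sub_self_eq_zero (hdeep h)]
    exact mul_nonneg zero_le_two (klEdge_nonneg hG n hρ)
  · rw [klEdge_eq_bhi_of_le G (not_lt.mp h)]
    exact (kled_sum_abs_sub_self_le w).trans (by linarith)

/-- The same with the deep-inside hypothesis phrased on the weights' summands: every weight is a finite sum of terms with nonnegative
real part deep inside the class. -/
theorem kled_negMass_clause_of_terms {G : GeoConsts} (hG : 0 ≤ G.bhi) {n : ℕ} {ρ : ℝ} (hρ : 0 ≤ ρ) {ι : Type*} (F : Finset ι)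
    (z : S → ι → ℂ) {w : S → ℝ} (hw : ∀ p, w p = (∑ i ∈ F, z p i).re) (hmass : ∑ p, |w p| ≤ G.bhi)
    (hdeep : klEdgeKappa * ρ < klScale klE0 n → ∀ p, ∀ i ∈ F, 0 ≤ (z p i).re) :
    ∑ p, (|w p| - w p) ≤ 2 * klEdge G n ρ :=
  kled_negMass_clause hG hρ hmass fun h p => (hw p).symm ▸ kled_sum_re_nonneg F (hdeep h p)

end Clause

/-! ## §3 The geometric input, arithmetic part -/

/-- **Deep inside the class the pair-energy gap is below half the scale**: a gradient bound `|e(p) − e(p′)| ≤ 7·d` along a step of Euclidean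
length `d ≤ √2·ρ` (`ρ` = torus sup-size of `Qm`) gives `|e(p) − e(p′)| ≤ Λ/2` as soon as `klEdgeKappa·ρ ≤ Λ` (`7√2 < 10 ≤ 64/2`). -/
theorem kled_gap_of_gradient {g d ρ Λ : ℝ} (hg : |g| ≤ 7 * d) (hd : d ≤ Real.sqrt 2 * ρ) (hρ : klEdgeKappa * ρ ≤ Λ) : |g| ≤ Λ / 2 := by
  have hs : Real.sqrt 2 ≤ 3 / 2 := by
    rw [Real.sqrt_le_left (by norm_num)]; norm_num
  unfold klEdgeKappa at hρ
  rcases le_or_gt 0 ρ with h0 | h0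
  · have h : d ≤ 3 / 2 * ρ := hd.trans (mul_le_mul_of_nonneg_right hs h0)
    linarith
  · have : d < 0 := lt_of_le_of_lt hd (mul_neg_of_pos_of_neg (Real.sqrt_pos.mpr (by norm_num)) h0)
    linarith [abs_nonneg g]

/-! ## §4 The in-class scale sum of the edge profile (child 1's growth exponent) -/

/-- **The in-class scale sum of the edge profile**: over the scales `j ≤ m` at which a momentum of torus size `ρ ≥ 0` is still pair-class at
`m` (`ρ·4^m ≤ 1`), `Σ_{j ≤ m} min 1 (2ρ·4^{j+5}) ≤ 7` (the last six scales cost `≤ 1` each, the deeper ones a geometric `≤ 2/3`). -/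
theorem kled_sum_min_one_edge_le {ρ : ℝ} (hρ : 0 ≤ ρ) {m : ℕ} (hm : ρ * 4 ^ m ≤ 1) :
    ∑ j ∈ range (m + 1), min (1 : ℝ) (2 * ρ * 4 ^ (j + 5)) ≤ 7 := by
  have hterm : ∀ j, min (1 : ℝ) (2 * ρ * 4 ^ (j + 5)) ≤ 1 := fun j => min_le_left _ _
  rcases le_or_gt (m + 1) 6 with h6 | h6
  · calc ∑ j ∈ range (m + 1), min (1 : ℝ) (2 * ρ * 4 ^ (j + 5)) ≤ ∑ j ∈ range (m + 1), (1 : ℝ) := sum_le_sum fun j _ => hterm j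
      _ = (m + 1 : ℕ) := by simp
      _ ≤ 7 := by exact_mod_cast (by omega : m + 1 ≤ 7)
  · rw [← sum_range_add_sum_Ico _ (show m - 5 ≤ m + 1 by omega)]
    have hcard : (Finset.Ico (m - 5) (m + 1)).card = 6 := by simp; omega
    have h1 : ∑ j ∈ Finset.Ico (m - 5) (m + 1), min (1 : ℝ) (2 * ρ * 4 ^ (j + 5)) ≤ 6 := by
      calc ∑ j ∈ Finset.Ico (m - 5) (m + 1), min (1 : ℝ) (2 * ρ * 4 ^ (j + 5)) ≤ ∑ j ∈ Finset.Ico (m - 5) (m + 1), (1 : ℝ) :=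
            sum_le_sum fun j _ => hterm j
        _ = 6 := by rw [sum_const, hcard]; norm_num
    have hgeom : ∑ j ∈ range (m - 5), (4 : ℝ) ^ j ≤ 4 ^ (m - 5) / 3 := by
      rw [geom_sum_eq (by norm_num : (4 : ℝ) ≠ 1)]
      have : (0 : ℝ) < 4 ^ (m - 5) := by positivity
      rw [div_le_div_iff₀ (by norm_num) (by norm_num)]
      linarith
    have hpow : (4 : ℝ) ^ 5 * 4 ^ (m - 5) = 4 ^ m := by
      rw [← pow_add]; congr 1; omega
    have h2 : ∑ j ∈ range (m - 5), min (1 : ℝ) (2 * ρ * 4 ^ (j + 5)) ≤ 2 / 3 := by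
      calc ∑ j ∈ range (m - 5), min (1 : ℝ) (2 * ρ * 4 ^ (j + 5)) ≤ ∑ j ∈ range (m - 5), 2 * ρ * 4 ^ (j + 5) :=
            sum_le_sum fun j _ => min_le_right _ _
        _ = 2 * ρ * 4 ^ 5 * ∑ j ∈ range (m - 5), (4 : ℝ) ^ j := by
            rw [mul_sum]; exact sum_congr rfl fun j _ => by ring
        _ ≤ 2 * ρ * 4 ^ 5 * (4 ^ (m - 5) / 3) := mul_le_mul_of_nonneg_left hgeom (by positivity)
        _ = 2 / 3 * (ρ * 4 ^ m) := by rw [← hpow]; ring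
        _ ≤ 2 / 3 := by nlinarith
    linarith

/-- The same for the profile itself: `Σ_{j ≤ m} klEdge G j ρ ≤ 7·G.bhi` whenever `0 ≤ G.bhi`, `0 ≤ ρ`, `ρ·4^m ≤ 1`. -/
theorem kled_sum_klEdge_le {G : GeoConsts} (hG : 0 ≤ G.bhi) {ρ : ℝ} (hρ : 0 ≤ ρ) {m : ℕ} (hm : ρ * 4 ^ m ≤ 1) :
    ∑ j ∈ range (m + 1), klEdge G j ρ ≤ 7 * G.bhi := by
  simp_rw [klEdge_eq_pow, ← mul_sum]
  rw [mul_comm]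
  exact mul_le_mul_of_nonneg_right (kled_sum_min_one_edge_le hρ hm) hG

/-- **Per pair-class momentum the edge allowance is scale-summable**: if `Qm` is pair-class at resolution `m` (`|Qm|_𝕋 ≤ 4^{−m}`), then
`Σ_{j ≤ m} klEdge G j |Qm|_𝕋 ≤ 7·G.bhi` — the exponent of child 1's signed-cascade growth factor `Π_j (1 + 2u_j·Σw⁻_j)`. -/
theorem kled_sum_klEdge_le_of_isPairClassAt {L : ℕ} [NeZero L] {G : GeoConsts} (hG : 0 ≤ G.bhi) {Qm : TorusSite 2 L} {m : ℕ}
    (h : IsPairClassAt L Qm m) : ∑ j ∈ range (m + 1), klEdge G j (klTorusNorm L Qm) ≤ 7 * G.bhi := by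
  have hρ : 0 ≤ klTorusNorm L Qm := KLProgrammeLegKernels.torusSupNorm_nonneg _
  refine kled_sum_klEdge_le hG hρ ?_
  have h4 : (0 : ℝ) < 4 ^ m := by positivity
  have h' : klTorusNorm L Qm ≤ ((4 : ℝ) ^ m)⁻¹ := h
  calc klTorusNorm L Qm * 4 ^ m ≤ ((4 : ℝ) ^ m)⁻¹ * 4 ^ m := mul_le_mul_of_nonneg_right h' h4.le
    _ = 1 := inv_mul_cancel₀ h4.ne'

/-! ## §5 The aggregated slice weights are REAL (`ν ↦ −ν`) -/

/-- Frequency reflection conjugates the pair denominator: `(i(−ν) − e₁)(−i(−ν) − e₂) = conj((iν − e₁)(−iν − e₂))`. -/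
theorem kled_pairDenom_neg_freq (ν e₁ e₂ : ℝ) :
    ((I * ((-ν : ℝ) : ℂ) - e₁) * (-I * ((-ν : ℝ) : ℂ) - e₂)) = (starRingEnd ℂ) ((I * ν - e₁) * (-I * ν - e₂)) := by
  apply Complex.ext <;>
    simp only [map_mul, map_sub, conj_ofReal, ofReal_neg, mul_re, mul_im, sub_re, sub_im, neg_re, neg_im, conj_re, conj_im,
      I_re, I_im, ofReal_re, ofReal_im, neg_mul, mul_neg] <;> ring

/-- Hence the pair weight with a real, frequency-even numerator is conjugated by `ν ↦ −ν`. -/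
theorem kled_pairWeight_neg_freq (a ν e₁ e₂ : ℝ) :
    ((a : ℂ) / ((I * ((-ν : ℝ) : ℂ) - e₁) * (-I * ((-ν : ℝ) : ℂ) - e₂))) = (starRingEnd ℂ) ((a : ℂ) / ((I * ν - e₁) * (-I * ν - e₂))) := by
  rw [kled_pairDenom_neg_freq, map_div₀, conj_ofReal]

/-- **A sum over a reflection-symmetric index set of a conjugation-odd family is real**: for an involution `σ` with `f (σ i) = conj (f i)`,
`Im (Σ_i f i) = 0`. -/
theorem kled_sum_im_eq_zero_of_involutive {ι : Type*} [Fintype ι] (σ : ι → ι) (hσ : Function.Involutive σ) (f : ι → ℂ)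
    (hf : ∀ i, f (σ i) = (starRingEnd ℂ) (f i)) : (∑ i, f i).im = 0 := by
  have h1 : ∑ i, f i = ∑ i, f (σ i) := (Equiv.sum_comp (Function.Involutive.toPerm σ hσ) f).symm
  have h2 : ∑ i, f (σ i) = (starRingEnd ℂ) (∑ i, f i) := by rw [map_sum]; exact sum_congr rfl fun i _ => hf i
  have h := congrArg Complex.im (h1.trans h2)
  rw [conj_im] at h
  linarith

/-- **The aggregated slice pair weight over the truncated Matsubara set is real**: with the `2M` frequencies `ω_i` (`ω_{rev i} = −ω_i`,
`matsubaraFreq_rev`) and a numerator `a` even in the frequency, `Im Σ_i a(ω_i)/((iω_i − e₁)(−iω_i − e₂)) = 0`. -/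
theorem kled_matsubara_pairWeight_sum_im_eq_zero (β : ℝ) (M : ℕ) (a : ℝ → ℝ) (ha : ∀ ν, a (-ν) = a ν) (e₁ e₂ : ℝ) :
    (∑ i : MatsubaraIdx M, ((a (matsubaraFreq β M i) : ℝ) : ℂ) /
        ((I * (matsubaraFreq β M i : ℝ) - e₁) * (-I * (matsubaraFreq β M i : ℝ) - e₂))).im = 0 := by
  refine kled_sum_im_eq_zero_of_involutive Fin.rev Fin.rev_involutive _ fun i => ?_
  rw [matsubaraFreq_rev, ha, ← kled_pairWeight_neg_freq]

/-! ## §6 The total variation of the slice pair weights is Q-UNIFORM: bounded by the `Q = 0` slice bubble mass (AM–GM) -/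

section TotalVariation

variable {P F : Type*} [Fintype P] [Fintype F]

/-- `2·X·Y ≤ X² + Y²` bookkeeping for the pair weight: with `X = |a|/‖d₁‖`, `Y = |a′|/‖d₂‖`,
`‖c·a·a′/(d₁·d₂)‖ ≤ (c/2)·(a²/‖d₁‖² + a′²/‖d₂‖²)` for `c ≥ 0` (no non-vanishing of the denominators needed). -/
theorem kled_norm_pairWeight_le_amgm {c a a' : ℝ} (hc : 0 ≤ c) (d₁ d₂ : ℂ) :
    ‖(c : ℂ) * ((a * a' : ℝ) : ℂ) / (d₁ * d₂)‖ ≤ c / 2 * (a ^ 2 / ‖d₁‖ ^ 2 + a' ^ 2 / ‖d₂‖ ^ 2) := by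
  rw [norm_div, norm_mul, norm_mul, Complex.norm_real, Complex.norm_real, Real.norm_eq_abs, Real.norm_eq_abs, abs_of_nonneg hc,
    abs_mul]
  have key : |a| * |a'| / (‖d₁‖ * ‖d₂‖) ≤ (a ^ 2 / ‖d₁‖ ^ 2 + a' ^ 2 / ‖d₂‖ ^ 2) / 2 := by
    have h2 : 2 * (|a| / ‖d₁‖) * (|a'| / ‖d₂‖) ≤ (|a| / ‖d₁‖) ^ 2 + (|a'| / ‖d₂‖) ^ 2 := two_mul_le_add_sq _ _
    rw [div_pow, div_pow, sq_abs, sq_abs] at h2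
    rw [← div_mul_div_comm]
    linarith
  calc c * (|a| * |a'|) / (‖d₁‖ * ‖d₂‖) = c * (|a| * |a'| / (‖d₁‖ * ‖d₂‖)) := by ring
    _ ≤ c * ((a ^ 2 / ‖d₁‖ ^ 2 + a' ^ 2 / ‖d₂‖ ^ 2) / 2) := mul_le_mul_of_nonneg_left key hc
    _ = _ := by ring

/-- `‖iν − e‖² = ν² + e²`. -/
theorem kled_norm_sq_I_mul_sub (ν e : ℝ) : ‖(I * ν - e : ℂ)‖ ^ 2 = ν ^ 2 + e ^ 2 := by
  rw [Complex.sq_norm, Complex.normSq_apply]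
  simp only [sub_re, sub_im, mul_re, mul_im, I_re, I_im, ofReal_re, ofReal_im]
  ring

/-- `‖−iν − e‖² = ν² + e²`. -/
theorem kled_norm_sq_neg_I_mul_sub (ν e : ℝ) : ‖(-I * ν - e : ℂ)‖ ^ 2 = ν ^ 2 + e ^ 2 := by
  rw [Complex.sq_norm, Complex.normSq_apply]
  simp only [sub_re, sub_im, mul_re, mul_im, neg_re, neg_im, I_re, I_im, ofReal_re, ofReal_im]
  ring

/-- **The total variation of the slice pair weights at total momentum `Q` is bounded by the `Q = 0` slice bubble mass, uniformly in `Q`.**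
Generic carriers: momenta `P` with the bijection `τ = (p ↦ Qm − p)`, frequencies `F` with the reflection `σ = (ν ↦ −ν)` (`freq (σ i) = −freq i`);
slice multipliers `a i p` (real), energies `e p`, normalisation `c ≥ 0` (`(βL²)⁻¹`).  The pair weights
`z′_(p,i) = c·a(i,p)·a(σ i, τ p)/((i·freq i − e p)(−i·freq i − e (τ p)))` satisfy
`Σ_{p,i} ‖z′_(p,i)‖ ≤ c·Σ_{p,i} a(i,p)²/(freq i² + (e p)²)` — AM–GM termwise and the reindexing `(i,p) ↦ (σ i, τ p)`. -/
theorem kled_sum_norm_pairWeight_le_mass (τ : P ≃ P) (σ : F ≃ F) (freq : F → ℝ) (hfreq : ∀ i, freq (σ i) = -freq i)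
    (e : P → ℝ) (a : F → P → ℝ) {c : ℝ} (hc : 0 ≤ c) :
    ∑ p, ∑ i, ‖(c : ℂ) * ((a i p * a (σ i) (τ p) : ℝ) : ℂ) / ((I * freq i - e p) * (-I * freq i - e (τ p)))‖ ≤
      c * ∑ p, ∑ i, a i p ^ 2 / (freq i ^ 2 + e p ^ 2) := by
  set m : F → P → ℝ := fun i p => a i p ^ 2 / (freq i ^ 2 + e p ^ 2) with hm_def
  -- termwise AM–GM
  have hterm : ∀ p i, ‖(c : ℂ) * ((a i p * a (σ i) (τ p) : ℝ) : ℂ) / ((I * freq i - e p) * (-I * freq i - e (τ p)))‖ ≤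
      c / 2 * (m i p + m (σ i) (τ p)) := by
    intro p i
    refine (kled_norm_pairWeight_le_amgm hc _ _).trans (le_of_eq ?_)
    rw [kled_norm_sq_I_mul_sub, kled_norm_sq_neg_I_mul_sub, hm_def]
    simp only [hfreq, neg_sq]
  -- the reflected mass sums to the same total
  have hreindex : ∑ p, ∑ i, m (σ i) (τ p) = ∑ p, ∑ i, m i p := by
    calc ∑ p, ∑ i, m (σ i) (τ p) = ∑ p, ∑ i, m i (τ p) := sum_congr rfl fun p _ => Equiv.sum_comp σ (fun i => m i (τ p))
      _ = ∑ p, ∑ i, m i p := Equiv.sum_comp τ (fun p => ∑ i, m i p)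
  calc ∑ p, ∑ i, ‖(c : ℂ) * ((a i p * a (σ i) (τ p) : ℝ) : ℂ) / ((I * freq i - e p) * (-I * freq i - e (τ p)))‖
      ≤ ∑ p, ∑ i, c / 2 * (m i p + m (σ i) (τ p)) := sum_le_sum fun p _ => sum_le_sum fun i _ => hterm p i
    _ = c / 2 * (∑ p, ∑ i, m i p + ∑ p, ∑ i, m (σ i) (τ p)) := by
        rw [mul_add, mul_sum, mul_sum, ← sum_add_distrib]
        refine sum_congr rfl fun p _ => ?_
        rw [mul_sum, mul_sum, ← sum_add_distrib]
        exact sum_congr rfl fun i _ => by ring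
    _ = c * ∑ p, ∑ i, m i p := by rw [hreindex]; ring

/-- **Hence the aggregated real slice weights have `Q`-uniform total variation**: with `w p := Σ_i Re z′_(p,i)`,
`Σ_p |w p| ≤ c·Σ_{p,i} a(i,p)²/(freq i² + (e p)²)` — the `Σ|w| ≤ G.bhi` conjunct of (E2-v8) follows from ONE bound on the `Q = 0` mass. -/
theorem kled_sum_abs_aggregated_le_mass (τ : P ≃ P) (σ : F ≃ F) (freq : F → ℝ) (hfreq : ∀ i, freq (σ i) = -freq i)
    (e : P → ℝ) (a : F → P → ℝ) {c : ℝ} (hc : 0 ≤ c) {w : P → ℝ}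
    (hw : ∀ p, w p = (∑ i, (c : ℂ) * ((a i p * a (σ i) (τ p) : ℝ) : ℂ) / ((I * freq i - e p) * (-I * freq i - e (τ p)))).re) :
    ∑ p, |w p| ≤ c * ∑ p, ∑ i, a i p ^ 2 / (freq i ^ 2 + e p ^ 2) := by
  refine le_trans (sum_le_sum fun p _ => ?_) (kled_sum_norm_pairWeight_le_mass τ σ freq hfreq e a hc)
  rw [hw p, re_sum]
  exact (abs_sum_le_sum_abs _ _).trans (sum_le_sum fun i _ => Complex.abs_re_le_norm _)

end TotalVariation

/-! ## §7 The `Q = 0` slice bubble mass is sign-blind: `≤ (4/Λ²)·#{frequencies below 4Λ}·#{momenta in the shell}` -/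

section MassCount

variable {P F : Type*} [Fintype P] [Fintype F]

/-- **The `Q = 0` slice bubble mass on the product carrier is bounded by a count**: multipliers `|a| ≤ 1` supported where
`Λ²/4 < ω² + e² < (4Λ)²` (the slice between `Λ_n = Λ` and `Λ_{n−1} = 4Λ`) give
`Σ_{p,i} a(i,p)²/(ω_i² + e_p²) ≤ (4/Λ²)·#{i : |ω_i| < 4Λ}·#{p : |e_p| < 4Λ}` — with `kled_sum_norm_pairWeight_le_mass` the (m) conjunct of
(E2-v8) at `w := z` is this count times `(βL²)⁻¹` (Matsubara window count × shell count, both in the tree for admissible frames). -/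
theorem kled_mass_le_card_mul_card [DecidableEq P] [DecidableEq F] (freq : F → ℝ) (e : P → ℝ) (a : F → P → ℝ) {Λ : ℝ} (hΛ : 0 < Λ)
    (ha1 : ∀ i p, |a i p| ≤ 1) (hsupp : ∀ i p, a i p ≠ 0 → Λ ^ 2 / 4 < freq i ^ 2 + e p ^ 2 ∧ freq i ^ 2 + e p ^ 2 < (4 * Λ) ^ 2) :
    ∑ p, ∑ i, a i p ^ 2 / (freq i ^ 2 + e p ^ 2) ≤
      4 / Λ ^ 2 * ((univ.filter fun i : F => |freq i| < 4 * Λ).card : ℝ) * ((univ.filter fun p : P => |e p| < 4 * Λ).card : ℝ) := by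
  classical
  -- termwise: `a²/(ω²+e²) ≤ (4/Λ²)·𝟙[|ω| < 4Λ]·𝟙[|e| < 4Λ]`
  have hterm : ∀ p i, a i p ^ 2 / (freq i ^ 2 + e p ^ 2) ≤
      4 / Λ ^ 2 * ((if |freq i| < 4 * Λ then (1 : ℝ) else 0) * (if |e p| < 4 * Λ then (1 : ℝ) else 0)) := by
    intro p i
    by_cases ha : a i p = 0
    · rw [ha]
      have : (0 : ℝ) ≤ 4 / Λ ^ 2 * ((if |freq i| < 4 * Λ then (1 : ℝ) else 0) * (if |e p| < 4 * Λ then (1 : ℝ) else 0)) := by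
        have h1 : (0 : ℝ) ≤ (if |freq i| < 4 * Λ then (1 : ℝ) else 0) := by split_ifs <;> norm_num
        have h2 : (0 : ℝ) ≤ (if |e p| < 4 * Λ then (1 : ℝ) else 0) := by split_ifs <;> norm_num
        positivity
      simpa using this
    · obtain ⟨hlo, hhi⟩ := hsupp i p ha
      have hω : |freq i| < 4 * Λ := by
        have : freq i ^ 2 < (4 * Λ) ^ 2 := by nlinarith [sq_nonneg (e p)]
        exact abs_lt_of_sq_lt_sq this (by linarith)
      have he : |e p| < 4 * Λ := by
        have : e p ^ 2 < (4 * Λ) ^ 2 := by nlinarith [sq_nonneg (freq i)]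
        exact abs_lt_of_sq_lt_sq this (by linarith)
      rw [if_pos hω, if_pos he, mul_one, mul_one]
      have hden : 0 < freq i ^ 2 + e p ^ 2 := by nlinarith [sq_nonneg Λ]
      have hsq : a i p ^ 2 ≤ 1 := by
        have h := ha1 i p
        have : a i p ^ 2 = |a i p| ^ 2 := (sq_abs _).symm
        rw [this]; nlinarith [abs_nonneg (a i p)]
      rw [div_le_div_iff₀ hden (by positivity)]
      nlinarith
  calc ∑ p, ∑ i, a i p ^ 2 / (freq i ^ 2 + e p ^ 2)
      ≤ ∑ p, ∑ i, 4 / Λ ^ 2 * ((if |freq i| < 4 * Λ then (1 : ℝ) else 0) * (if |e p| < 4 * Λ then (1 : ℝ) else 0)) :=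
        sum_le_sum fun p _ => sum_le_sum fun i _ => hterm p i
    _ = 4 / Λ ^ 2 * ((∑ p, (if |e p| < 4 * Λ then (1 : ℝ) else 0)) * ∑ i, (if |freq i| < 4 * Λ then (1 : ℝ) else 0)) := by
        rw [Finset.sum_mul_sum (s := (univ : Finset P)) (t := (univ : Finset F)), Finset.mul_sum]
        refine sum_congr rfl fun p _ => ?_
        rw [Finset.mul_sum]
        exact sum_congr rfl fun i _ => by ring
    _ = 4 / Λ ^ 2 * ((univ.filter fun i : F => |freq i| < 4 * Λ).card : ℝ) * ((univ.filter fun p : P => |e p| < 4 * Λ).card : ℝ) := by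
        rw [Finset.sum_boole, Finset.sum_boole]; ring

end MassCount

end Summit.HubbardSuperconductivity.HubbardSuperconductivity.Theorems.KLRegimeSplit

end
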